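/-
Origin: expansion seat `planner-pub-hodgecm-toy-0`, handover #3 2026-08-18T05:09:35Z (`HOME/pub-hodgecm-toy/lean/Toy/Duality.lean`, md5 2a9a0d09, 1241 lines);
landed by the gen-6 packager in gate run 22 as `HodgeCM/Model/Toy/Duality.lean` (import ^import Toy\.→import HodgeCM.Model.Toy. ×3).
-/
-- HANDOVER (planner-pub-hodgecm-toy-0, unit pub-hodgecm-toy): WIP module `Toy.Duality`; intended final module
-- `HodgeCM.Model.Toy.Duality` (kind L5, toy model / consistency witness); rename `import Toy.X` ↦ the final prefix.
/-
Copyright (c) 2026. All rights reserved.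
Released under Apache 2.0 license as described in the file LICENSE.
-/
import Summits.HodgeConjecture.HodgeCM.Model.Toy.Weil_2
import Summits.HodgeConjecture.HodgeCM.Model.Toy.Isogeny
import Summits.HodgeConjecture.HodgeCM.Model.Toy.ExteriorHodge

/-!
# M28 `Fact_algDuality` in the exterior model: the twisted trace-form star

Part R: the model-specific reduction — a diagonal action `IsDiagAct K Φ a M` forces
`M.lin = dμ a` (diagonal multiplication), and the numerology `2 (dim P - 2) + 4 = #slots`.
Part S: the twisted trace-form star `D : ⋀^{4n-4}_ℚ L → ⋀^4_ℚ L`,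
`D y = Σ_{a,b,c,d} λ(y ∧ β_a ∧ β_b ∧ β_c ∧ β_d) · β'_a ∧ β'_b ∧ β'_c ∧ β'_d` over the rational trace basis
`β` of `L = F⁴` and its CONJUGATE trace-dual basis `β'_m = c(β^∨_m)` (S1 Casimir identity
`Σ_m β_m ⊗ c(β^∨_m) = Σ_τ e_τ ⊗ e_τ̄`, S3–S7 complexification `Θ(1 ⊗ D y) = cst⁻¹ · T4_{e,ē}(Θ(1 ⊗ y))`
and the eigen-monomial calculus: Hodge types, S8 equivariance `μ(ā)^* D μ(a)^* = N(a)⁴ D`,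
S9 injectivity by the wedge test, S10 assembly).  Main result: `fact_algDuality :
(toyModelWith exteriorHodgeData).Fact_algDuality` — M28 is a THEOREM of the exterior model.
-/

noncomputable section

namespace HodgeCM.Toy

open Literature.AlgebraicGeometry.Motives
open Literature.AlgebraicGeometry.Motives.HodgeStructure (EndAction conj ofRat ofRat_apply complexConj
  mem_hodgeClasses_iff)
open Literature.AlgebraicGeometry.ShimuraVarieties (conjRingHomK embedding_conjRingHomK)
open scoped TensorProduct
open exteriorPower CMPresentation Module

variable (K : CMField) (Φ : Fin 4 → CMType K)

section R

/-- the constant family `i ↦ eK a` on the four atoms of `P` -/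
def cK (a : K) : (i : (PP K Φ).s.toType) → ((PP K Φ).atom i).F
  | Sum.inl (Sum.inl (Sum.inl _)) => eK K a
  | Sum.inl (Sum.inl (Sum.inr _)) => eK K a
  | Sum.inl (Sum.inr _) => eK K a
  | Sum.inr _ => eK K a

/-- diagonal multiplication by `a ∈ K` on `L P = F⁴` -/
def dμ (a : K) : (PP K Φ).L →ₗ[ℚ] (PP K Φ).L :=
  LinearMap.pi fun i => LinearMap.mulLeft ℚ (cK K Φ a i) ∘ₗ LinearMap.proj i

/-- (Ported verbatim from the HodgeCMPerL package; no docstring in the source.) -/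
@[simp] lemma dμ_apply (a : K) (x : (PP K Φ).L) (i : (PP K Φ).s.toType) :
    dμ K Φ a x i = cK K Φ a i * x i := rfl

/-- (Ported verbatim from the HodgeCMPerL package; no docstring in the source.) -/
lemma dμ_single (a : K) (i : (PP K Φ).s.toType) (y : ((PP K Φ).atom i).F) :
    dμ K Φ a (Pi.single i y) = Pi.single i (cK K Φ a i * y) := by
  funext i'
  rw [dμ_apply]
  by_cases h : i' = i
  · subst h; rw [Pi.single_eq_same, Pi.single_eq_same]
  · rw [Pi.single_eq_of_ne h, Pi.single_eq_of_ne h, mul_zero]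

variable (D : HodgeData)

namespace Obj
variable {X Y : Obj}
/-- (Ported verbatim from the HodgeCMPerL package; no docstring in the source.) -/
lemma inlL_single (i : X.s.toType) (y : (X.atom i).F) :
    X.inlL Y (Pi.single i y) = Pi.single (M := fun j => (((X.prod Y).atom j).F : Type)) (Sum.inl i) y := by
  exact LinearMap.congr_fun (X.inlL_comp_single (Y := Y) i) y
/-- (Ported verbatim from the HodgeCMPerL package; no docstring in the source.) -/
lemma inrL_single (i : Y.s.toType) (y : (Y.atom i).F) :
    X.inrL Y (Pi.single i y) = Pi.single (M := fun j => (((X.prod Y).atom j).F : Type)) (Sum.inr i) y := by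
  exact LinearMap.congr_fun (X.inrL_comp_single (Y := Y) i) y
end Obj

section pr4
variable (K : CMField) (Φ : Fin 4 → CMType K)
/-- shorthand for the atoms and partial products of `P` -/
abbrev A (j : Fin 4) : Obj := cmObj K (Φ j)
/-- (Ported verbatim from the HodgeCMPerL package; no docstring in the source.) -/
abbrev X2 : Obj := (A K Φ 0).prod (A K Φ 1)
/-- (Ported verbatim from the HodgeCMPerL package; no docstring in the source.) -/
abbrev X3 : Obj := (X2 K Φ).prod (A K Φ 2)

/-- (Ported verbatim from the HodgeCMPerL package; no docstring in the source.) -/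
lemma pr4_lin_0 : ((toyModelWith D).pr4 K Φ 0).lin
    = (X3 K Φ).inlL (A K Φ 3) ∘ₗ ((X2 K Φ).inlL (A K Φ 2) ∘ₗ (A K Φ 0).inlL (A K Φ 1)) := rfl
/-- (Ported verbatim from the HodgeCMPerL package; no docstring in the source.) -/
lemma pr4_lin_1 : ((toyModelWith D).pr4 K Φ 1).lin
    = (X3 K Φ).inlL (A K Φ 3) ∘ₗ ((X2 K Φ).inlL (A K Φ 2) ∘ₗ (A K Φ 0).inrL (A K Φ 1)) := rfl
/-- (Ported verbatim from the HodgeCMPerL package; no docstring in the source.) -/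
lemma pr4_lin_2 : ((toyModelWith D).pr4 K Φ 2).lin
    = (X3 K Φ).inlL (A K Φ 3) ∘ₗ (X2 K Φ).inrL (A K Φ 2) := rfl
/-- (Ported verbatim from the HodgeCMPerL package; no docstring in the source.) -/
lemma pr4_lin_3 : ((toyModelWith D).pr4 K Φ 3).lin = (X3 K Φ).inrL (A K Φ 3) := rfl

/-- `pr_j^*` on `H¹` sends the coordinate vector of `A_j` to the coordinate vector of slot `j`. -/
lemma pr4_lin_single_0 (y : FK K) :
    ((toyModelWith D).pr4 K Φ 0).lin (Pi.single (M := fun _ : Unit => (FK K : Type)) () y)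
      = Pi.single (M := fun i => (((PP K Φ).atom i).F : Type)) (Sum.inl (Sum.inl (Sum.inl ()))) y := by
  rw [pr4_lin_0]
  simp only [LinearMap.comp_apply]
  rw [Obj.inlL_single, Obj.inlL_single, Obj.inlL_single]
  rfl

/-- (Ported verbatim from the HodgeCMPerL package; no docstring in the source.) -/
lemma pr4_lin_single_1 (y : FK K) :
    ((toyModelWith D).pr4 K Φ 1).lin (Pi.single (M := fun _ : Unit => (FK K : Type)) () y)
      = Pi.single (M := fun i => (((PP K Φ).atom i).F : Type)) (Sum.inl (Sum.inl (Sum.inr ()))) y := by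
  rw [pr4_lin_1]
  simp only [LinearMap.comp_apply]
  rw [Obj.inrL_single, Obj.inlL_single, Obj.inlL_single]
  rfl

/-- (Ported verbatim from the HodgeCMPerL package; no docstring in the source.) -/
lemma pr4_lin_single_2 (y : FK K) :
    ((toyModelWith D).pr4 K Φ 2).lin (Pi.single (M := fun _ : Unit => (FK K : Type)) () y)
      = Pi.single (M := fun i => (((PP K Φ).atom i).F : Type)) (Sum.inl (Sum.inr ())) y := by
  rw [pr4_lin_2]
  simp only [LinearMap.comp_apply]
  rw [Obj.inrL_single, Obj.inlL_single]
  rfl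

/-- (Ported verbatim from the HodgeCMPerL package; no docstring in the source.) -/
lemma pr4_lin_single_3 (y : FK K) :
    ((toyModelWith D).pr4 K Φ 3).lin (Pi.single (M := fun _ : Unit => (FK K : Type)) () y)
      = Pi.single (M := fun i => (((PP K Φ).atom i).F : Type)) (Sum.inr ()) y := by
  rw [pr4_lin_3, Obj.inrL_single]
  rfl
end pr4

/-- `map 1` is faithful. -/
lemma map_one_injective {M N : Type*} [AddCommGroup M] [Module ℚ M] [AddCommGroup N] [Module ℚ N]
    {f g : M →ₗ[ℚ] N} (h : map 1 f = map 1 g) : f = g := by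
  rw [map_one_eq, map_one_eq] at h
  ext x
  have := LinearMap.congr_fun h (((oneEquiv ℚ M).symm x))
  simpa using this

variable {K Φ D}

/-- A diagonal action commutes with the four inclusions through multiplication by `a`. -/
lemma lin_pr4_apply {a : K} {M : (toyModelWith D).Mor (PP K Φ) (PP K Φ)}
    (hM : (toyModelWith D).IsDiagAct K Φ a M) (j : Fin 4) (x : (cmObj K (Φ j)).L) :
    M.lin (((toyModelWith D).pr4 K Φ j).lin x) = ((toyModelWith D).pr4 K Φ j).lin (mulK K (Φ j) a x) := by
  obtain ⟨e, he1, he2⟩ := hM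
  have h2 : map 1 M.lin ∘ₗ map 1 ((toyModelWith D).pr4 K Φ j).lin
      = map 1 ((toyModelWith D).pr4 K Φ j).lin ∘ₗ map 1 (e j).lin := he2 j 1
  have h1 : map 1 (e j).lin = map 1 (mulK K (Φ j) a) := by
    have := he1 j; rw [cmAct_ι_eq] at this; exact this
  have h3 : map 1 (M.lin ∘ₗ ((toyModelWith D).pr4 K Φ j).lin)
      = map 1 (((toyModelWith D).pr4 K Φ j).lin ∘ₗ (e j).lin) := by
    rw [map_comp, map_comp]; exact h2
  have h4 := LinearMap.congr_fun (map_one_injective h3) x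
  have h5 : (e j).lin = mulK K (Φ j) a := map_one_injective h1
  rw [h5] at h4
  exact h4

/-- (Ported verbatim from the HodgeCMPerL package; no docstring in the source.) -/
lemma lin_pr4_single {a : K} {M : (toyModelWith D).Mor (PP K Φ) (PP K Φ)}
    (hM : (toyModelWith D).IsDiagAct K Φ a M) (j : Fin 4) (y : FK K) :
    M.lin (((toyModelWith D).pr4 K Φ j).lin (Pi.single (M := fun _ : Unit => (FK K : Type)) () y))
      = ((toyModelWith D).pr4 K Φ j).lin (Pi.single (M := fun _ : Unit => (FK K : Type)) () (eK K a * y)) := by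
  rw [lin_pr4_apply hM j, mulK_single]

/-- **R1.** A diagonal action is diagonal multiplication on `H¹`. -/
theorem lin_eq_dμ {a : K} {M : (toyModelWith D).Mor (PP K Φ) (PP K Φ)}
    (hM : (toyModelWith D).IsDiagAct K Φ a M) : M.lin = dμ K Φ a := by
  refine LinearMap.pi_ext fun i y => ?_
  rcases i with ((i | i) | i) | i <;> cases i
  · rw [← pr4_lin_single_0 D K Φ y, lin_pr4_single hM, pr4_lin_single_0, pr4_lin_single_0, dμ_single]; rfl
  · rw [← pr4_lin_single_1 D K Φ y, lin_pr4_single hM, pr4_lin_single_1, pr4_lin_single_1, dμ_single]; rfl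
  · rw [← pr4_lin_single_2 D K Φ y, lin_pr4_single hM, pr4_lin_single_2, pr4_lin_single_2, dμ_single]; rfl
  · rw [← pr4_lin_single_3 D K Φ y, lin_pr4_single hM, pr4_lin_single_3, pr4_lin_single_3, dμ_single]; rfl

variable (K Φ)

/-- (Ported verbatim from the HodgeCMPerL package; no docstring in the source.) -/
lemma card_s_PP : Fintype.card (PP K Φ).s.toType = 4 := rfl

/-- **R2.** `#slots(P) = 4 [K:ℚ]`. -/
lemma card_idx_PP : Fintype.card (PP K Φ).Idx = 4 * Module.finrank ℚ K := by
  have h : ∀ i : (PP K Φ).s.toType,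
      Fintype.card (((PP K Φ).atom i).F →+* ℂ) = Module.finrank ℚ K := by
    intro i
    rcases i with ((i | i) | i) | i <;> cases i <;>
      exact (NumberField.Embeddings.card (FK K) ℂ).trans (finrank_FK K)
  rw [Fintype.card_sigma, Finset.sum_congr rfl (fun i _ => h i), Finset.sum_const, Finset.card_univ,
    card_s_PP, smul_eq_mul]

/-- (Ported verbatim from the HodgeCMPerL package; no docstring in the source.) -/
lemma finrank_L_PP : Module.finrank ℚ (PP K Φ).L = 4 * Module.finrank ℚ K := by
  have h : ∀ i : (PP K Φ).s.toType,
      Module.finrank ℚ ((PP K Φ).atom i).F = Module.finrank ℚ K := by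
    intro i
    rcases i with ((i | i) | i) | i <;> cases i <;> exact finrank_FK K
  rw [Module.finrank_pi_fintype, Finset.sum_congr rfl (fun i _ => h i), Finset.sum_const,
    Finset.card_univ, card_s_PP, smul_eq_mul]

/-- (Ported verbatim from the HodgeCMPerL package; no docstring in the source.) -/
lemma dim_PP : (toyModelWith D).dim (PP K Φ) = 2 * Module.finrank ℚ K := by
  rw [dim_eq, finrank_L_PP]
  change 4 * Module.finrank ℚ K / 2 + 0 = _
  omega

/-- (Ported verbatim from the HodgeCMPerL package; no docstring in the source.) -/
lemma four_add_k₀ :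
    4 + 2 * ((toyModelWith D).dim (PP K Φ) - 2) = Fintype.card (PP K Φ).Idx := by
  rw [dim_PP, card_idx_PP]
  have : 0 < Module.finrank ℚ K := Module.finrank_pos
  omega

end R

/-! ## Part S1: the Casimir element of the conjugate trace form -/

section Casimir

variable {F : Type*} [Field F] [NumberField F]

open scoped ComplexConjugate

/-- `1 ⊗ x` expanded in the basis `1 ⊗ b_m`. -/
lemma one_tmul_eq_sum (x : F) :
    (1 : ℂ) ⊗ₜ[ℚ] x = ∑ m, ((Algebra.trace ℚ F (dF F m * x) : ℚ) : ℂ) • ((1 : ℂ) ⊗ₜ[ℚ] bF F m) := by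
  conv_lhs => rw [← sum_trace_dF_mul_smul_bF F x]
  rw [TensorProduct.tmul_sum]
  refine Finset.sum_congr rfl fun m _ => ?_
  rw [TensorProduct.tmul_smul, ← algebraMap_smul ℂ (Algebra.trace ℚ F (dF F m * x))]
  rfl

/-- (Ported verbatim from the HodgeCMPerL package; no docstring in the source.) -/
lemma eps_eq_sum (τ : F →+* ℂ) : eps F τ = ∑ m, (τ (dF F m)) • ((1 : ℂ) ⊗ₜ[ℚ] bF F m) := by
  unfold eps
  refine Finset.sum_congr rfl fun m _ => ?_
  rw [TensorProduct.smul_tmul', smul_eq_mul, mul_one]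

variable (c : F →+* F) (hc : ∀ (τ : F →+* ℂ) (x : F), τ (c x) = conj (τ x))
include hc

/-- (Ported verbatim from the HodgeCMPerL package; no docstring in the source.) -/
lemma trace_conj_eq (x : F) : Algebra.trace ℚ F (c x) = Algebra.trace ℚ F x := by
  have h : ((Algebra.trace ℚ F (c x) : ℚ) : ℂ) = conj (((Algebra.trace ℚ F x : ℚ) : ℂ)) := by
    rw [trace_eq_sum_ringHom, trace_eq_sum_ringHom, map_sum]
    exact Finset.sum_congr rfl fun τ _ => hc τ x
  rw [map_ratCast] at h
  exact_mod_cast h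

/-- (Ported verbatim from the HodgeCMPerL package; no docstring in the source.) -/
lemma conj_involutive (x : F) : c (c x) = x := by
  have hpos : 0 < Fintype.card (F →+* ℂ) := by
    rw [NumberField.Embeddings.card]; exact Module.finrank_pos
  obtain ⟨τ⟩ := Fintype.card_pos_iff.mp hpos
  apply τ.injective
  rw [hc, hc]
  exact RCLike.conj_conj _


/-- **Atom Casimir**: `Σ_m (1 ⊗ b_m) ⊗ (1 ⊗ c d_m) = Σ_τ ε_τ ⊗ ε_{τ̄}` in `(ℂ ⊗ F) ⊗_ℂ (ℂ ⊗ F)`. -/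
theorem atom_casimir :
    ∑ m, ((1 : ℂ) ⊗ₜ[ℚ] bF F m) ⊗ₜ[ℂ] ((1 : ℂ) ⊗ₜ[ℚ] c (dF F m))
      = ∑ τ : F →+* ℂ, eps F τ ⊗ₜ[ℂ] eps F (NumberField.ComplexEmbedding.conjugate τ) := by
  have coef : ∀ m m' : Fin (Module.finrank ℚ F),
      ∑ τ : F →+* ℂ, τ (dF F m) * (NumberField.ComplexEmbedding.conjugate τ) (dF F m')
        = ((Algebra.trace ℚ F (dF F m' * c (dF F m)) : ℚ) : ℂ) := by
    intro m m'
    have h1 : Algebra.trace ℚ F (dF F m' * c (dF F m)) = Algebra.trace ℚ F (dF F m * c (dF F m')) := by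
      rw [← trace_conj_eq c hc (dF F m' * c (dF F m)), map_mul, conj_involutive c hc, mul_comm]
    rw [h1, trace_eq_sum_ringHom]
    refine Finset.sum_congr rfl fun τ _ => ?_
    rw [map_mul, hc, NumberField.ComplexEmbedding.conjugate_coe_eq]
  calc ∑ m, ((1 : ℂ) ⊗ₜ[ℚ] bF F m) ⊗ₜ[ℂ] ((1 : ℂ) ⊗ₜ[ℚ] c (dF F m))
      = ∑ m, ∑ m', ((Algebra.trace ℚ F (dF F m' * c (dF F m)) : ℚ) : ℂ) •
          (((1 : ℂ) ⊗ₜ[ℚ] bF F m) ⊗ₜ[ℂ] ((1 : ℂ) ⊗ₜ[ℚ] bF F m')) := by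
        refine Finset.sum_congr rfl fun m _ => ?_
        rw [one_tmul_eq_sum (c (dF F m)), TensorProduct.tmul_sum]
        refine Finset.sum_congr rfl fun m' _ => ?_
        rw [TensorProduct.tmul_smul]
    _ = ∑ m, ∑ m', (∑ τ : F →+* ℂ, τ (dF F m) * (NumberField.ComplexEmbedding.conjugate τ) (dF F m')) •
          (((1 : ℂ) ⊗ₜ[ℚ] bF F m) ⊗ₜ[ℂ] ((1 : ℂ) ⊗ₜ[ℚ] bF F m')) := by
        simp_rw [coef]
    _ = ∑ τ : F →+* ℂ, ∑ m, ∑ m', (τ (dF F m) * (NumberField.ComplexEmbedding.conjugate τ) (dF F m')) •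
          (((1 : ℂ) ⊗ₜ[ℚ] bF F m) ⊗ₜ[ℂ] ((1 : ℂ) ⊗ₜ[ℚ] bF F m')) := by
        simp_rw [Finset.sum_smul]
        symm
        rw [Finset.sum_comm]
        refine Finset.sum_congr rfl fun m _ => ?_
        exact Finset.sum_comm
    _ = ∑ τ : F →+* ℂ, eps F τ ⊗ₜ[ℂ] eps F (NumberField.ComplexEmbedding.conjugate τ) := by
        refine Finset.sum_congr rfl fun τ _ => ?_
        rw [eps_eq_sum, eps_eq_sum, TensorProduct.sum_tmul]
        refine Finset.sum_congr rfl fun m _ => ?_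
        rw [TensorProduct.tmul_sum]
        refine Finset.sum_congr rfl fun m' _ => ?_
        rw [TensorProduct.smul_tmul, TensorProduct.tmul_smul, TensorProduct.tmul_smul, smul_smul, mul_comm]

omit hc in
/-- **Casimir swap** (rank one): equal Casimir tensors give equal contracted sums. -/
lemma casimir_swap {ι κ V M : Type*} [Fintype ι] [Fintype κ] [AddCommGroup V] [Module ℂ V]
    [AddCommGroup M] [Module ℂ M] {u u' : ι → V} {v v' : κ → V}
    (h : ∑ i, u i ⊗ₜ[ℂ] u' i = ∑ s, v s ⊗ₜ[ℂ] v' s) (α : V →ₗ[ℂ] ℂ) (φ : V →ₗ[ℂ] M) :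
    ∑ i, α (u i) • φ (u' i) = ∑ s, α (v s) • φ (v' s) := by
  have := congrArg (TensorProduct.lift ((LinearMap.lsmul ℂ M).compl₁₂ α φ)) h
  simpa only [map_sum, TensorProduct.lift.tmul, LinearMap.compl₁₂_apply, LinearMap.lsmul_apply] using this

end Casimir


/-! ## Part S2: the generic four-fold swap -/

section Swap

variable {R : Type*} [Field R] {V : Type*} [AddCommGroup V] [Module R V]

/-- **Casimir swap** (bilinear form): equal Casimir tensors give equal contracted sums. -/
lemma casimir_swap₂ {ι κ M : Type*} [Fintype ι] [Fintype κ] [AddCommGroup M] [Module R M]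
    {u u' : ι → V} {v v' : κ → V} (h : ∑ i, u i ⊗ₜ[R] u' i = ∑ s, v s ⊗ₜ[R] v' s)
    (B : V →ₗ[R] V →ₗ[R] M) (f : V → V → M) (hf : ∀ x y, f x y = B x y) :
    ∑ i, f (u i) (u' i) = ∑ s, f (v s) (v' s) := by
  have := congrArg (TensorProduct.lift B) h
  simp only [map_sum, TensorProduct.lift.tmul] at this
  simpa only [hf] using this

variable (R V) in
/-- the embedding `V = ⋀¹ V` -/
abbrev ι1 : V →ₗ[R] ⋀[R]^1 V := (oneEquiv R V).symm.toLinearMap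

/-- `W4 z x₀ x₁ x₂ x₃ = (((z ∧ x₀) ∧ x₁) ∧ x₂) ∧ x₃` -/
abbrev W4 {k : ℕ} (z : ⋀[R]^k V) (x₀ x₁ x₂ x₃ : V) : ⋀[R]^(k+1+1+1+1) V :=
  wedge R V (k+1+1+1) 1 (wedge R V (k+1+1) 1 (wedge R V (k+1) 1 (wedge R V k 1 z
    (ι1 R V x₀)) (ι1 R V x₁)) (ι1 R V x₂)) (ι1 R V x₃)

/-- `W4' y₀ y₁ y₂ y₃ = ((y₀ ∧ y₁) ∧ y₂) ∧ y₃` -/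
abbrev W4' (y₀ y₁ y₂ y₃ : V) : ⋀[R]^(1+1+1+1) V :=
  wedge R V (1+1+1) 1 (wedge R V (1+1) 1 (wedge R V 1 1 (ι1 R V y₀) (ι1 R V y₁)) (ι1 R V y₂)) (ι1 R V y₃)

/-- the four-fold contracted sum over a pair of families -/
def T4 {ι : Type*} [Fintype ι] {k : ℕ} (vol : ⋀[R]^(k+1+1+1+1) V →ₗ[R] R) (u u' : ι → V)
    (z : ⋀[R]^k V) : ⋀[R]^(1+1+1+1) V :=
  ∑ a, ∑ b, ∑ c, ∑ d, vol (W4 z (u a) (u b) (u c) (u d)) • W4' (u' a) (u' b) (u' c) (u' d)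

/-- `z ↦ W4 z x₀ x₁ x₂ x₃` as a linear map -/
abbrev W4L (k : ℕ) (x₀ x₁ x₂ x₃ : V) : ⋀[R]^k V →ₗ[R] ⋀[R]^(k+1+1+1+1) V :=
  (wedge R V (k+1+1+1) 1).flip (ι1 R V x₃) ∘ₗ (wedge R V (k+1+1) 1).flip (ι1 R V x₂)
    ∘ₗ (wedge R V (k+1) 1).flip (ι1 R V x₁) ∘ₗ (wedge R V k 1).flip (ι1 R V x₀)

/-- `T4` as a linear map -/
def T4L {ι : Type*} [Fintype ι] {k : ℕ} (vol : ⋀[R]^(k+1+1+1+1) V →ₗ[R] R) (u u' : ι → V) :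
    ⋀[R]^k V →ₗ[R] ⋀[R]^(1+1+1+1) V :=
  ∑ a, ∑ b, ∑ c, ∑ d, (vol ∘ₗ W4L k (u a) (u b) (u c) (u d)).smulRight (W4' (u' a) (u' b) (u' c) (u' d))

/-- (Ported verbatim from the HodgeCMPerL package; no docstring in the source.) -/
lemma T4L_apply {ι : Type*} [Fintype ι] {k : ℕ} (vol : ⋀[R]^(k+1+1+1+1) V →ₗ[R] R) (u u' : ι → V)
    (z : ⋀[R]^k V) : T4L vol u u' z = T4 vol u u' z := by
  simp only [T4L, T4, LinearMap.sum_apply, LinearMap.smulRight_apply]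
  rfl

/-- rank-one bilinear map `(x,y) ↦ α x • φ y` -/
abbrev r1 {M : Type*} [AddCommGroup M] [Module R M] (α : V →ₗ[R] R) (φ : V →ₗ[R] M) :
    V →ₗ[R] V →ₗ[R] M := (LinearMap.lsmul R M).compl₁₂ α φ


-- port_pkg: scope closed for this part
end Swap
end HodgeCM.Toy
end
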